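import Mathlib
import Literature.Computability.Complexity.RossmanMonotoneCliqueGraphs
import Summits.PneNP.PneNP.Theorems.ConvexRankGatesLinAlgGateBlindDefs
import Summits.PneNP.PneNP.Theorems.ConvexRankGatesLinAlgGateBlindDenseRegimeAux

/-!
# SG_PERM for permutation gates with few subgroups (line `dnf-invariant-wide-gates-see-small-cliques`, crux `LinAlgGateBlind`, stmt-PneNP-10681, route ConvexRankGates): the two numeric budgets (auxiliary file)

The planting theorem `sg_of_maxtermCover` (`…Theorems.ConvexRankGatesLinAlgGateBlindPlanting`) turns a maxterm
cover of a term gate `O` by `N` all-off events into a small-clique DNF losing at most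
`(ν·C(l,2))^t · C(m-t, k-t)` bare `k`-cliques and gaining at most `#𝒱(l)·η` of `G(m,q)`, provided
`N·(1/2)^{ν+1} < η` and `2t ≤ l`. This file supplies, in the dense regime of the line at `δ = 1/8`
(`k = kOf m`, `l = lOf m`, `ε = epsOf c m = 1/(4 m^{c+1})`, module `…DenseRegimeAux`) and with the choices
`ν = ⌈m^{3/4}⌉₊`, `t = ⌊l/2⌋`, `η = ε/#𝒱(l)`, the two numeric budgets consumed by the corollary
`sgAt_perm_of_fewSubgroups` (`…Theorems.ConvexRankGatesLinAlgGateBlindPermSmallDim`), eventually in `m` for every `c`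
(registered auxiliary statement `permSmallDim_budgets`):

* POSITIVE budget `(ν·C(l,2))^t · C(m-t, k-t) ≤ ε · C(m,k)`: by the tree inequality
  `C(m-t,k-t)·m^t ≤ k^t·C(m,k)` (`choose_sub_mul_pow_le_pow_mul_choose`) it suffices that `(ν·C(l,2)·k/m)^t ≤ ε`;
  here `ν·C(l,2)·k ≤ 2m^{3/4} · k/(2(4 log₂ m + 1)) · 2m^{1/8} ≤ 4m/(4 log₂ m + 1)` (`lOf_sq_le`, `kOf_le_two_mul_sq`),
  so the base is `≤ 1/log m`, and `(log m)^t ≥ e^t ≥ 4 m^{c+1}` once `log log m ≥ 1` and `l ≥ 2(c+1) log m + 7`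
  (`eventually_log_le_lOf`, from `(log m)^4 = o(m^{1/8})`);
* FRAGILITY budget `2^{m^{3/4}/2} · (1/2)^{ν+1} · #𝒱(l) < ε`: `#𝒱(l) ≤ (m+1)^l` (`card_smallSets_le`) and
  `log 2 + (c+1) log m + l·log(m+1) ≤ 1 + 5x²/16 < x^{12}/4 ≤ (m^{3/4}/2)·log 2` at the scale `x = m^{1/16}`
  (`16 log m ≤ x`, `l ≤ x + 1`, `c + 1 ≤ x`).

Elementary real-analysis bookkeeping only; no definitions, nothing asserted without proof. [folklore]
-/

-- `Summit.PneNP.PneNP.…` duplicates `PneNP` BY DESIGN (single-problem summit).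
set_option linter.dupNamespace false

noncomputable section

namespace Summit.PneNP.PneNP.Cruxes.LinAlgGateBlind.DnfInvariantWideGatesSeeSmallCliques

open scoped BigOperators
open Finset Filter Literature.Computability.Complexity Razborov

namespace PermSmallDim

open DenseRegime

/-! ### The scale `m^{3/4} = x^{12}` (`x = m^{1/16}`) and the fragility parameter `ν = ⌈m^{3/4}⌉₊` -/

/-- `(m^{1/16})^{12} = m^{3/4}`. [folklore] -/
theorem rpow_sixteenth_pow_twelve (m : ℕ) : ((m : ℝ) ^ (1 / 16 : ℝ)) ^ 12 = (m : ℝ) ^ (3 / 4 : ℝ) := by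
  rw [← Real.rpow_natCast, ← Real.rpow_mul (Nat.cast_nonneg m)]
  norm_num

/-- `ν = ⌈m^{3/4}⌉₊ ≤ 2 x^{12}` for `m ≥ 1`. [folklore] -/
theorem ceil_le_two_mul_pow_twelve {m : ℕ} (hm : 1 ≤ m) :
    (⌈(m : ℝ) ^ (3 / 4 : ℝ)⌉₊ : ℝ) ≤ 2 * ((m : ℝ) ^ (1 / 16 : ℝ)) ^ 12 := by
  have h1 : (⌈(m : ℝ) ^ (3 / 4 : ℝ)⌉₊ : ℝ) < (m : ℝ) ^ (3 / 4 : ℝ) + 1 :=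
    Nat.ceil_lt_add_one (Real.rpow_nonneg (Nat.cast_nonneg m) _)
  have h2 : (1 : ℝ) ≤ ((m : ℝ) ^ (1 / 16 : ℝ)) ^ 12 := one_le_pow₀ (one_le_rpow_sixteenth hm)
  rw [rpow_sixteenth_pow_twelve] at h2 ⊢
  linarith

/-- **The base of the positive budget.** `ν · C(l,2) · k ≤ 4m/(4 log₂ m + 1)`: `ν ≤ 2x^{12}`, `k ≤ 2x²`,
`C(l,2)·(4 log₂ m + 1) ≤ l²(4 log₂ m + 1)/2 ≤ k/2 ≤ x²` and `m = x^{16}`. [folklore] -/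
theorem base_le {m : ℕ} (hm : 1 ≤ m) :
    (⌈(m : ℝ) ^ (3 / 4 : ℝ)⌉₊ : ℝ) * (((lOf m).choose 2 : ℕ) : ℝ) * (kOf m : ℝ) ≤
      4 * (m : ℝ) / (4 * Real.logb 2 m + 1) := by
  set x := (m : ℝ) ^ (1 / 16 : ℝ) with hxdef
  have hx1 : 1 ≤ x := one_le_rpow_sixteenth hm
  have hL := denom_pos m
  have hν := ceil_le_two_mul_pow_twelve hm
  have hk := kOf_le_two_mul_sq hm
  have hk0 : 0 ≤ (kOf m : ℝ) := Nat.cast_nonneg _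
  have hCL : (((lOf m).choose 2 : ℕ) : ℝ) * (4 * Real.logb 2 m + 1) ≤ (kOf m : ℝ) / 2 := by
    have h1 : (((lOf m).choose 2 : ℕ) : ℝ) ≤ (lOf m : ℝ) ^ 2 / 2 := by
      rw [Nat.cast_choose_two]
      nlinarith [(Nat.cast_nonneg (lOf m) : (0 : ℝ) ≤ lOf m)]
    have h2 : (lOf m : ℝ) ^ 2 * (4 * Real.logb 2 m + 1) ≤ kOf m := (le_div_iff₀ hL).1 (lOf_sq_le m)
    nlinarith [hL.le]
  rw [le_div_iff₀ hL]
  calc (⌈(m : ℝ) ^ (3 / 4 : ℝ)⌉₊ : ℝ) * (((lOf m).choose 2 : ℕ) : ℝ) * (kOf m : ℝ) * (4 * Real.logb 2 m + 1)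
      = (⌈(m : ℝ) ^ (3 / 4 : ℝ)⌉₊ : ℝ) * (kOf m : ℝ) * ((((lOf m).choose 2 : ℕ) : ℝ) * (4 * Real.logb 2 m + 1)) := by
        ring
    _ ≤ 2 * x ^ 12 * (2 * x ^ 2) * ((kOf m : ℝ) / 2) :=
        mul_le_mul (mul_le_mul hν hk hk0 (by positivity)) hCL (by positivity) (by positivity)
    _ ≤ 2 * x ^ 12 * (2 * x ^ 2) * x ^ 2 := by
        refine mul_le_mul_of_nonneg_left ?_ (by positivity)
        linarith
    _ = 4 * x ^ 16 := by ring
    _ = 4 * (m : ℝ) := by rw [rpow_sixteenth_pow]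

/-! ### The positive budget -/

/-- **Positive budget (pointwise).** If `m ≥ 3`, `x ≥ 2`, `log log m ≥ 1` and `l ≥ 2(c+1) log m + 7`, then
`(ν·C(l,2))^t · C(m-t, k-t) ≤ ε·C(m,k)` for `ν = ⌈m^{3/4}⌉₊`, `t = ⌊l/2⌋`: multiply by `m^t`, use
`C(m-t,k-t) m^t ≤ k^t C(m,k)`, `ν·C(l,2)·k ≤ 4m/(4 log₂ m + 1)`, `4/(4 log₂ m + 1) ≤ 1/log m` and
`4 m^{c+1} ≤ e^t ≤ (log m)^t` (`t ≥ (c+1) log m + 3 ≥ (c+1) log m + log 4`). [folklore] -/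
theorem pos_budget {c m : ℕ} (hm : 3 ≤ m) (hx2 : (2 : ℝ) ≤ (m : ℝ) ^ (1 / 16 : ℝ))
    (hlogl : 1 ≤ Real.log (Real.log m)) (hl : 2 * ((c : ℝ) + 1) * Real.log m + 7 ≤ lOf m) :
    (((⌈(m : ℝ) ^ (3 / 4 : ℝ)⌉₊ * (lOf m).choose 2) ^ (lOf m / 2) *
        (m - lOf m / 2).choose (kOf m - lOf m / 2) : ℕ) : ℝ) ≤ epsOf c m * (m.choose (kOf m) : ℝ) := by
  set ν := ⌈(m : ℝ) ^ (3 / 4 : ℝ)⌉₊ with hν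
  set l := lOf m with hldef
  set k := kOf m with hkdef
  set t := l / 2 with ht
  set L := 4 * Real.logb 2 m + 1 with hLdef
  have hm1 : 1 ≤ m := by omega
  have hmpos : (0 : ℝ) < m := by exact_mod_cast (show 0 < m by omega)
  have hL : 0 < L := denom_pos m
  have hlog1 : 1 ≤ Real.log m := one_le_log hm
  have hlogpos : 0 < Real.log m := by linarith
  -- `t ≤ k ≤ m` and the tree inequality
  have htk : t ≤ k := by
    have := lOf_add_one_le_kOf hx2
    omega
  have hkm : k ≤ m := kOf_le_self m
  have hnat := choose_sub_mul_pow_le_pow_mul_choose t m k htk hkm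
  have hreal : (((m - t).choose (k - t) : ℕ) : ℝ) * (m : ℝ) ^ t ≤ (k : ℝ) ^ t * (m.choose k : ℝ) := by
    exact_mod_cast hnat
  -- the base
  have hbase : (ν : ℝ) * ((l.choose 2 : ℕ) : ℝ) * (k : ℝ) ≤ 4 / L * m :=
    calc (ν : ℝ) * ((l.choose 2 : ℕ) : ℝ) * (k : ℝ) ≤ 4 * (m : ℝ) / L := base_le hm1
      _ = 4 / L * m := by ring
  -- `(4/L)^t ≤ ε`
  have h4L : (4 / L) ^ t ≤ epsOf c m := by
    have h1 : 4 / L ≤ 1 / Real.log m := by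
      rw [div_le_div_iff₀ hL hlogpos]
      have := log_le_logb_two m
      linarith
    have h2 : (1 / Real.log m) ^ t ≤ epsOf c m := by
      rw [epsOf_eq, one_div_pow]
      apply one_div_le_one_div_of_le (by positivity)
      rw [← Real.log_le_log_iff (by positivity) (pow_pos hlogpos t),
        Real.log_mul (by norm_num) (pow_ne_zero _ hmpos.ne'), Real.log_pow, Real.log_pow]
      have hlog4 : Real.log 4 ≤ 3 := by
        have := Real.log_le_sub_one_of_pos (by norm_num : (0 : ℝ) < 4)
        linarith
      have ht2 : (l : ℝ) ≤ 2 * (t : ℝ) + 1 := by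
        have : l ≤ 2 * t + 1 := by omega
        exact_mod_cast this
      calc Real.log 4 + ((c + 1 : ℕ) : ℝ) * Real.log m ≤ (t : ℝ) * 1 := by push_cast; linarith
        _ ≤ (t : ℝ) * Real.log (Real.log m) := mul_le_mul_of_nonneg_left hlogl (Nat.cast_nonneg _)
    exact (pow_le_pow_left₀ (by positivity) h1 t).trans h2
  -- assemble
  have hmt : (0 : ℝ) < (m : ℝ) ^ t := pow_pos hmpos t
  refine le_of_mul_le_mul_right ?_ hmt
  calc (((ν * l.choose 2) ^ t * (m - t).choose (k - t) : ℕ) : ℝ) * (m : ℝ) ^ t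
      = ((ν : ℝ) * ((l.choose 2 : ℕ) : ℝ)) ^ t * ((((m - t).choose (k - t) : ℕ) : ℝ) * (m : ℝ) ^ t) := by
        push_cast
        ring
    _ ≤ ((ν : ℝ) * ((l.choose 2 : ℕ) : ℝ)) ^ t * ((k : ℝ) ^ t * (m.choose k : ℝ)) :=
        mul_le_mul_of_nonneg_left hreal (by positivity)
    _ = ((ν : ℝ) * ((l.choose 2 : ℕ) : ℝ) * k) ^ t * (m.choose k : ℝ) := by
        rw [mul_pow]
        ring
    _ ≤ (4 / L * m) ^ t * (m.choose k : ℝ) :=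
        mul_le_mul_of_nonneg_right (pow_le_pow_left₀ (by positivity) hbase t) (Nat.cast_nonneg _)
    _ = (4 / L) ^ t * (m.choose k : ℝ) * (m : ℝ) ^ t := by
        rw [mul_pow]
        ring
    _ ≤ epsOf c m * (m.choose k : ℝ) * (m : ℝ) ^ t := by gcongr

/-! ### The fragility budget -/

/-- **Fragility budget (pointwise).** If `m ≥ 3`, `16 log m ≤ x` and `c + 3 ≤ x` (`x = m^{1/16}`), then
`2^{m^{3/4}/2} · (1/2)^{ν+1} · #𝒱(l) < ε` for `ν = ⌈m^{3/4}⌉₊`: with `z = 2^{m^{3/4}/2}`,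
`(1/2)^{ν+1} ≤ 1/(2z²)`, `#𝒱(l) ≤ (m+1)^l`, and `2 m^{c+1} (m+1)^l < z` because
`log 2 + (c+1) log m + l log(m+1) ≤ 1 + 5x²/16 < x^{12}/4 ≤ (x^{12}/2) log 2`. [folklore] -/
theorem frag_budget {c m : ℕ} (hm : 3 ≤ m) (hL : 16 * Real.log m ≤ (m : ℝ) ^ (1 / 16 : ℝ))
    (hc : (c : ℝ) + 3 ≤ (m : ℝ) ^ (1 / 16 : ℝ)) :
    (2 : ℝ) ^ ((m : ℝ) ^ (3 / 4 : ℝ) / 2) * (1 / 2) ^ (⌈(m : ℝ) ^ (3 / 4 : ℝ)⌉₊ + 1) *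
        #(smallSets (Fin m) (lOf m)) < epsOf c m := by
  set x := (m : ℝ) ^ (1 / 16 : ℝ) with hxdef
  set y := (m : ℝ) ^ (3 / 4 : ℝ) with hydef
  set ν := ⌈y⌉₊ with hνdef
  set l := lOf m with hldef
  have hm1 : 1 ≤ m := by omega
  have hmpos : (0 : ℝ) < m := by exact_mod_cast (show 0 < m by omega)
  have hc0 : (0 : ℝ) ≤ c := Nat.cast_nonneg c
  have hx2 : (2 : ℝ) ≤ x := by linarith
  have hx0 : (0 : ℝ) ≤ x := by linarith
  have hyx : y = x ^ 12 := (rpow_sixteenth_pow_twelve m).symm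
  have hlog1 : 1 ≤ Real.log m := one_le_log hm
  have hlog0 : 0 ≤ Real.log m := by linarith
  -- `z = 2^{y/2}`
  set z := (2 : ℝ) ^ (y / 2) with hzdef
  have hz : 0 < z := Real.rpow_pos_of_pos two_pos _
  have hzz : z * z = (2 : ℝ) ^ y := by rw [hzdef, ← Real.rpow_add two_pos, add_halves]
  -- `(1/2)^{ν+1} ≤ 1/(2 z²)`
  have hhalf : (1 / 2 : ℝ) ^ (ν + 1) ≤ 1 / (2 * (z * z)) := by
    rw [hzz, one_div_pow, pow_succ]
    refine one_div_le_one_div_of_le (by positivity) ?_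
    have h1 : (2 : ℝ) ^ y ≤ (2 : ℝ) ^ (ν : ℝ) := Real.rpow_le_rpow_of_exponent_le one_le_two (Nat.le_ceil y)
    rw [Real.rpow_natCast] at h1
    linarith
  -- `#𝒱(l) ≤ (m+1)^l`
  have hV : (#(smallSets (Fin m) l) : ℝ) ≤ ((m + 1 : ℕ) : ℝ) ^ l := by
    have := card_smallSets_le (α := Fin m) l
    rw [Fintype.card_fin] at this
    exact_mod_cast this
  -- the key exponential comparison `2 m^{c+1} (m+1)^l < z`
  have hkey : 2 * (m : ℝ) ^ (c + 1) * ((m + 1 : ℕ) : ℝ) ^ l < z := by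
    have hX : (0 : ℝ) < 2 * (m : ℝ) ^ (c + 1) * ((m + 1 : ℕ) : ℝ) ^ l := by positivity
    rw [hzdef, Real.lt_rpow_iff_log_lt hX two_pos, Real.log_mul (by positivity) (by positivity),
      Real.log_mul (by norm_num) (by positivity), Real.log_pow, Real.log_pow]
    have hlog2 := Real.log_two_lt_d9
    have hlog2' := Real.log_two_gt_d9
    have hm1' : Real.log ((m + 1 : ℕ) : ℝ) ≤ 1 + Real.log m := by
      have h2m : ((m + 1 : ℕ) : ℝ) ≤ 2 * m := by
        have : m + 1 ≤ 2 * m := by omega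
        exact_mod_cast this
      calc Real.log ((m + 1 : ℕ) : ℝ) ≤ Real.log (2 * m) := Real.log_le_log (by positivity) h2m
        _ = Real.log 2 + Real.log m := Real.log_mul (by norm_num) hmpos.ne'
        _ ≤ 1 + Real.log m := by linarith
    have hl2x : (l : ℝ) ≤ 2 * x := by
      have := lOf_le_rpow_add_one m
      rw [← hxdef] at this
      linarith
    have hl0 : (0 : ℝ) ≤ l := Nat.cast_nonneg _
    have hA : ((c + 1 : ℕ) : ℝ) * Real.log m ≤ x * (x / 16) := by
      push_cast
      exact mul_le_mul (by linarith) (by linarith) hlog0 hx0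
    have hB : (l : ℝ) * Real.log ((m + 1 : ℕ) : ℝ) ≤ 2 * x * (2 * (x / 16)) :=
      mul_le_mul hl2x (hm1'.trans (by linarith)) (Real.log_natCast_nonneg _) (by positivity)
    have hx10 : (1024 : ℝ) ≤ x ^ 10 := le_trans (by norm_num) (pow_le_pow_left₀ (by norm_num) hx2 10)
    have h12 : 1024 * x ^ 2 ≤ x ^ 12 :=
      calc 1024 * x ^ 2 ≤ x ^ 10 * x ^ 2 := mul_le_mul_of_nonneg_right hx10 (sq_nonneg x)
        _ = x ^ 12 := by ring
    have hxsq : (4 : ℝ) ≤ x ^ 2 := by nlinarith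
    have hR : x ^ 12 / 4 ≤ y / 2 * Real.log 2 := by
      rw [hyx]
      nlinarith [pow_nonneg hx0 12]
    calc Real.log 2 + ((c + 1 : ℕ) : ℝ) * Real.log m + (l : ℝ) * Real.log ((m + 1 : ℕ) : ℝ)
        ≤ 1 + x * (x / 16) + 2 * x * (2 * (x / 16)) := by linarith
      _ = 1 + 5 * x ^ 2 / 16 := by ring
      _ < x ^ 12 / 4 := by nlinarith
      _ ≤ y / 2 * Real.log 2 := hR
  -- assemble
  have hε : epsOf c m = 1 / (4 * (m : ℝ) ^ (c + 1)) := epsOf_eq c m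
  calc z * (1 / 2 : ℝ) ^ (ν + 1) * #(smallSets (Fin m) l)
      ≤ z * (1 / (2 * (z * z))) * ((m + 1 : ℕ) : ℝ) ^ l :=
        mul_le_mul (mul_le_mul_of_nonneg_left hhalf hz.le) hV (Nat.cast_nonneg _) (by positivity)
    _ = ((m + 1 : ℕ) : ℝ) ^ l / (2 * z) := by
        field_simp
    _ < epsOf c m := by
        rw [hε, div_lt_div_iff₀ (by positivity) (by positivity), one_mul]
        nlinarith [hkey]

/-! ### Eventual facts -/

/-- Eventually `(log m)^4 ≤ m^{1/8}` (`(log x)^4 = o(x^{1/8})`). [folklore] -/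
theorem eventually_log_pow_four_le : ∀ᶠ m : ℕ in atTop, Real.log m ^ 4 ≤ (m : ℝ) ^ (1 / 8 : ℝ) := by
  have h := ((isLittleO_log_rpow_rpow_atTop (4 : ℝ) (by norm_num : (0 : ℝ) < 1 / 8)).comp_tendsto
    tendsto_natCast_atTop_atTop).def zero_lt_one
  filter_upwards [h] with m hm
  have h1 : ‖Real.log m ^ (4 : ℝ)‖ = Real.log m ^ 4 := by
    rw [Real.rpow_ofNat, Real.norm_of_nonneg (by positivity)]
  have h2 : ‖(m : ℝ) ^ (1 / 8 : ℝ)‖ = (m : ℝ) ^ (1 / 8 : ℝ) :=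
    Real.norm_of_nonneg (Real.rpow_nonneg (Nat.cast_nonneg m) _)
  simp only [Function.comp_def] at hm
  rw [h1, h2, one_mul] at hm
  exact hm

/-- Eventually `1 ≤ log log m`. [folklore] -/
theorem eventually_one_le_loglog : ∀ᶠ m : ℕ in atTop, 1 ≤ Real.log (Real.log m) :=
  (Real.tendsto_log_atTop.comp (Real.tendsto_log_atTop.comp tendsto_natCast_atTop_atTop)).eventually_ge_atTop 1

/-- Eventually `K ≤ log m`. [folklore] -/
theorem eventually_le_log (K : ℝ) : ∀ᶠ m : ℕ in atTop, K ≤ Real.log m :=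
  (Real.tendsto_log_atTop.comp tendsto_natCast_atTop_atTop).eventually_ge_atTop K

/-- A lower bound for `l = ⌊√(k/(4 log₂ m + 1))⌋₊`: if `(B+1)²(4 log₂ m + 1) ≤ k` then `B < l`. [folklore] -/
theorem lt_lOf_of_sq_mul_le {m : ℕ} {B : ℝ} (h : (B + 1) ^ 2 * (4 * Real.logb 2 m + 1) ≤ (kOf m : ℝ)) :
    B < lOf m := by
  have hL := denom_pos m
  have h1 : (B + 1) ^ 2 ≤ (kOf m : ℝ) / (4 * Real.logb 2 m + 1) := by rwa [le_div_iff₀ hL]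
  have h2 : B + 1 ≤ Real.sqrt ((kOf m : ℝ) / (4 * Real.logb 2 m + 1)) := Real.le_sqrt_of_sq_le h1
  have h3 := Nat.lt_floor_add_one (Real.sqrt ((kOf m : ℝ) / (4 * Real.logb 2 m + 1)))
  unfold lOf
  linarith

/-- Eventually `2(c+1) log m + 7 ≤ l`: `(2(c+1) log m + 8)² (4 log₂ m + 1) ≤ 9(2c+10)² (log m)³ ≤ (log m)⁴ ≤ m^{1/8} ≤ k`.
[folklore] -/
theorem eventually_log_le_lOf (c : ℕ) : ∀ᶠ m : ℕ in atTop, 2 * ((c : ℝ) + 1) * Real.log m + 7 ≤ lOf m := by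
  filter_upwards [eventually_ge_atTop 3, eventually_log_pow_four_le,
    eventually_le_log (9 * (2 * (c : ℝ) + 10) ^ 2)] with m hm h4 hK
  have hlog1 := one_le_log hm
  have hc0 : (0 : ℝ) ≤ c := Nat.cast_nonneg c
  have hB1 : 2 * ((c : ℝ) + 1) * Real.log m + 7 + 1 ≤ (2 * (c : ℝ) + 10) * Real.log m := by nlinarith
  have hB0 : 0 ≤ 2 * ((c : ℝ) + 1) * Real.log m + 7 + 1 := by positivity
  have hLle : 4 * Real.logb 2 m + 1 ≤ 9 * Real.log m := by
    have := logb_two_le_two_mul_log m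
    linarith
  refine le_of_lt (lt_lOf_of_sq_mul_le ?_)
  calc (2 * ((c : ℝ) + 1) * Real.log m + 7 + 1) ^ 2 * (4 * Real.logb 2 m + 1)
      ≤ ((2 * (c : ℝ) + 10) * Real.log m) ^ 2 * (9 * Real.log m) :=
        mul_le_mul (pow_le_pow_left₀ hB0 hB1 2) hLle (denom_pos m).le (by positivity)
    _ = 9 * (2 * (c : ℝ) + 10) ^ 2 * Real.log m ^ 3 := by ring
    _ ≤ Real.log m * Real.log m ^ 3 := mul_le_mul_of_nonneg_right hK (by positivity)
    _ = Real.log m ^ 4 := by ring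
    _ ≤ (m : ℝ) ^ (1 / 8 : ℝ) := h4
    _ = ((m : ℝ) ^ (1 / 16 : ℝ)) ^ 2 := (rpow_sixteenth_sq m).symm
    _ ≤ kOf m := sq_le_kOf m

end PermSmallDim

/-! ### The two budgets, eventually -/

open DenseRegime PermSmallDim in
/-- **Numeric budgets of the corollary `sgAt_perm_of_fewSubgroups` (registered auxiliary statement).** For every `c`,
eventually in `m`, with `ν = ⌈m^{3/4}⌉₊` and `t = ⌊lOf m / 2⌋`: the positive budget
`(ν·C(l,2))^t · C(m-t, k-t) ≤ ε·C(m,k)` and the fragility budget `2^{m^{3/4}/2} · (1/2)^{ν+1} · #𝒱(l) < ε` of the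
planting theorem hold at `k = kOf m`, `l = lOf m`, `ε = epsOf c m`. [folklore] -/
theorem permSmallDim_budgets : ∀ c : ℕ, ∀ᶠ m : ℕ in atTop, (((⌈(m : ℝ) ^ (3 / 4 : ℝ)⌉₊ * (lOf m).choose 2) ^ (lOf m / 2) * (m - lOf m / 2).choose (kOf m - lOf m / 2) : ℕ) : ℝ) ≤ epsOf c m * (m.choose (kOf m) : ℝ) ∧ (2 : ℝ) ^ ((m : ℝ) ^ (3 / 4 : ℝ) / 2) * (1 / 2) ^ (⌈(m : ℝ) ^ (3 / 4 : ℝ)⌉₊ + 1) * #(smallSets (Fin m) (lOf m)) < epsOf c m := by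
  intro c
  filter_upwards [denseRegime_params c, eventually_one_le_loglog, eventually_log_le_lOf c] with m hP hll hl
  obtain ⟨hm4, hL, hc, -⟩ := hP
  have hm3 : 3 ≤ m := by omega
  have hx2 : (2 : ℝ) ≤ (m : ℝ) ^ (1 / 16 : ℝ) := by
    have : (0 : ℝ) ≤ c := Nat.cast_nonneg c
    linarith
  exact ⟨pos_budget hm3 hx2 hll hl, frag_budget hm3 hL hc⟩

end Summit.PneNP.PneNP.Cruxes.LinAlgGateBlind.DnfInvariantWideGatesSeeSmallCliques

end
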